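import Summits.QuantumFields.BalabanUV.T4Continuum.Spine.NE1p.DressedTowerWitnessPairBinders
import Summits.QuantumFields.BalabanUV.T4Continuum.Spine.NE1p.DressedStabilityOfCanonicalSliceWinSchedules

/-!
# T⁴ programme, spine estimate NE1′ (node O3b/H2) — TWO LIVE FAMILIES IN ONE MET COMPONENT WITH GENUINE ABSORPTION AT AN
# INTEGER BLOCKING FACTOR, part 3 of 3: anchoring on `ℕ⁴` with `L = 128`, the absorption DATA with `A = ⅛ > 0`, the booking
# convention, and THE CANONICAL TERMINAL FACE S3l APPLIED BY NAME on the datum of part 1 (formalisation crew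
# `b2b-balaban-t4-ne1p-formalise-*`, leaf seat 04, generation 3; witness row W13 of `t4/formal/NE1p/LEAVES.md`, INTENT HOME/CLAIMS.log l.11538, BOOKED typer R-T59 (v) l.11573)

Cell `pub-balaban`, sub-cell `t4`, BINDER-OWNERS row NE1′ (owner lineage t4-ne1p-p1).  ADDITIVE — imports part 2
`Spine/NE1p/DressedTowerWitnessPairBinders` (this seat; through it part 1 `DressedTowerWitnessPair`) and leaf-09's `Spine/NE1p/DressedStabilityOfCanonicalSliceWinSchedules` (row S3l,
p215128: THE CANONICAL TERMINAL FACE `dressedStabilityWith_of_canonicalSliceWinSchedules` ∕ `dressedStability_of_canonicalSliceWinSchedules`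
∕ `dressedBudget_of_canonicalSliceWinSchedules`) ONLY; modifies nothing.

WHAT.  §1 the ANCHORING `anchP K : Anchoring (BP K) 4 128` (every domain the zero block, every cube centred at the zero block —
W8's pattern at the integer `128`), per-block multiplicity `mB = 2` (`hmultP`), met components = the one cube of the current scale
(`compP`, `hscaleP`, volume `v = 1` `hvolP`), housing of BOTH live families (`hhousedP`); §2 the ABSORPTION DATA: the young family
absorbs the old one when it is genuinely younger (`SabsP`, `holderP`, `hsubP`), dressing sizes `βP K j = ½·τ^{K−j}` (`hβ` with
EQUALITY), and **`habsP` — the `AbsorbsFrom` binder with `A = ⅛` holding with EQUALITY for the young family**: `C·gen young 1 =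
β 1 + A·envVar C ρ old 1` (`envVar_oldP`: the old family's transported envelope at scale `k` is `C·ρ₀^k·gP K false`), strictly above
the dressing (`absorption_genuineP`); (w5) `hregP` (no regeneration — DECLARED ≡ 0); §3 the scalar set ONCE
`(κ, L, C, c̄, N₀, A₀, m, s̄⁰, ρ′, A, β₀, v, mB) = (½, 128, 2, 0, 2, 1, ⅛, ½, ½, ⅛, ½, 1, 2)`: (w6) `hsmallP` with EQUALITY `½ ≤ ½`,
fan-out `hfanP : fanout ⅛ 2 ½ = ½ < 1`, `hampP : absorbAmplitude ½ ⅛ 2 ½ = 1 ≤ A₀`, `hvN₀P : 1·2 ≤ 2`, `hLbP`; §4 **THE TERMINAL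
FACE FIRES**: `dressedStabilityWith_towerP : DressedStabilityWith towerP 1 (rhoOne 128⁻² 2 0 ½) 128⁻³`,
`dressedStability_towerP : DressedStability towerP` and ROOT-B `dressedBudget_towerP` for every bounded run-weight family — each by
ONE application of the corresponding S3l theorem BY NAME, its ≈ 50 displayed binders inhabited AT ONCE by part 1's function-level
lemmas (parts 1–2: both families, cross-family `SgP`, births at scales `0` and `1`, `hsupP` over a bounded attained increment set)
and this part's anchoring ∕ absorption ∕ scalar lemmas — NOT through END-B directly.

WHAT IT IS NOT.  A DECIDED TOY: joint inhabitation of hypothesis SHAPES; NOTHING of Bałaban's densities, components, D-terms, windows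
or of [Balaban1989LargeFieldII] (1.69)∕(1.79) absorption is modelled or asserted; `128` is the toy's integer, a kernel consequence of
`locCell` via `exp_three_lt`, never «Bałaban's L» (caveat k2).  [folklore] 0 sorry; 0 citations; no `def … : Prop` (the `def`s are
toy DATA).  Headline (c4): «the canonical terminal face's binder families — INCLUDING the cross-family H2 dictionary, a positive birth
scale and absorption data with A > 0 — are jointly inhabitable at function level at every cutoff with ONE K-free scalar set at an
integer blocking factor; non-vacuity of SHAPES; NE1′ ⇐ the named binders, NOT proved»; spine PROVED 0∕9.  Rung (B)+1 on ONE finite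
four-torus — NOT infinite volume, NOT a mass gap, NOT OS on ℝ⁴, NOT Clay, NOT summit progress.  HONEST DEPENDENCY: continuum YM on T⁴
⇐ BetaPertH ∧ nine spine estimates (0/9 proved); BetaPertH ⇐ (D1) ∧ (D4) ∧ CAP+tail; G-an2-4 gates asym, D1 and NE2/3/4.
-/

noncomputable section

namespace Summit.QuantumFields.BalabanUV.T4Continuum.NE1p.DressedTowerWitnessPair

open MeasureTheory Set Metric Filter Finset
open scoped BigOperators
open Literature.MathematicalPhysics.QuantumFieldTheory.Balaban1983to89
open Literature.MathematicalPhysics.QuantumFieldTheory.Balaban1983to89.T4TermFormat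
open Literature.MathematicalPhysics.QuantumFieldTheory.Balaban1983to89.T4TermFormat.Booking
open Literature.MathematicalPhysics.QuantumFieldTheory.Balaban1983to89.T4FeltGeometry
open Literature.MathematicalPhysics.QuantumFieldTheory.Balaban1983to89.T4GatedBooking
open Literature.MathematicalPhysics.QuantumFieldTheory.Balaban1983to89.T4TrajectoryComparison
open T4TrajectoryModulus (bondBall bondBall_add_mem bondBall_latMove_add_mem bondBall_diam)
open T4BlockTransport (Fld NDir latMove latN Site norm_dir_le)
open T4BirthChartTransport (GaugeInvariant BirthSlice RelGauge)
open T4TrajectoryDensity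
open Summit.QuantumFields.BalabanUV.T4Continuum.T4TrajectoryDensityDressed
open Summit.QuantumFields.BalabanUV.T4Continuum.T4TrajectoryDensityWitness
open Summit.QuantumFields.BalabanUV.T4Continuum.NE1p.DressedRoot
open Summit.QuantumFields.BalabanUV.T4Continuum.NE1p.DressedUniformConstants
open Summit.QuantumFields.BalabanUV.T4Continuum.NE1p.DressedAbsorptionWindow
open Summit.QuantumFields.BalabanUV.T4Continuum.NE1p.DressedWindowScheduleWin
open Summit.QuantumFields.BalabanUV.T4Continuum.NE1p.DressedWindowScheduleModWin
open Summit.QuantumFields.BalabanUV.T4Continuum.NE1p.DressedTowerWitness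
open Summit.QuantumFields.BalabanUV.T4Continuum.NE1p.DressedTowerWitnessSlice (exponentSliceAt_M)
open Summit.QuantumFields.BalabanUV.T4Continuum.NE1p.DressedAbsorptionWitness (bs bs_le bs_false bs_true)
open Summit.QuantumFields.BalabanUV.T4Continuum.NE1p.DressedStabilityOfCanonicalSliceWinSchedules

/-! ## §1 Anchoring on `ℕ⁴` with blocking integer `128`; housing of both live families [decided toy] -/

/-- THE ANCHORING ON `ℕ⁴` WITH BLOCKING INTEGER `128` [decided toy]: every localisation domain is the zero block of its scale, every
cube is centred at the zero block — which coarsens to itself under any number of `128`-fold blockings. [folklore] -/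
def anchP (K : ℕ) : Anchoring (BP K) 4 128 where
  dom := fun _ => {0}
  center := fun _ => 0
  felt_under := fun _ _ _ => ⟨0, Finset.mem_singleton_self _, by funext i; simp [coarsen]⟩

/-- Per-block multiplicity `mB = 2`: at most the two families have a given block in their domain. [folklore] -/
theorem hmultP (K : ℕ) : ∀ j (x : Fin 4 → ℕ),
    ((BP K).births.filter fun b => (BP K).birthScale b = j ∧ x ∈ (anchP K).dom b).card ≤ 2 := by
  intro j x
  show ((Finset.univ : Finset Bool).filter fun b => bs K b = j ∧ x ∈ ({0} : Finset (Fin 4 → ℕ))).card ≤ 2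
  exact (Finset.card_le_card (Finset.filter_subset _ _)).trans (by simp)

/-- Met components [decided toy]: the one cube of the current scale (none above the cutoff). [folklore] -/
def compP (K : ℕ) (k : ℕ) (_b : Bool) : Finset (Fin (K + 1)) :=
  if h : k ≤ K then {⟨k, Nat.lt_succ_of_le h⟩} else ∅

/-- The component's cubes have the current scale. [folklore] -/
theorem hscaleP (K : ℕ) : ∀ k b, ∀ q ∈ compP K k b, (BP K).cubeScale q = k := by
  intro k b q hq
  unfold compP at hq
  split_ifs at hq with h
  · rw [Finset.mem_singleton] at hq
    subst hq
    rfl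
  · simp at hq

/-- Component volume `v = 1`. [folklore] -/
theorem hvolP (K : ℕ) : ∀ k b, (compP K k b).card ≤ 1 := by
  intro k b; unfold compP; split_ifs <;> simp

/-- BOTH live families are housed: each is felt at the component's cube. [folklore] -/
theorem hhousedP (K : ℕ) : ∀ k b, ∀ f ∈ SP K k b, ∃ q ∈ compP K k b, f ∈ (BP K).feltAt q := by
  intro k b f hf
  obtain ⟨hfk, hkK⟩ := (Finset.mem_filter.mp hf).2
  refine ⟨⟨k, Nat.lt_succ_of_le hkK⟩, ?_, ?_⟩
  · unfold compP
    rw [dif_pos hkK]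
    exact Finset.mem_singleton_self _
  · exact Finset.mem_filter.mpr ⟨Finset.mem_univ _, hfk⟩

/-! ## §2 The absorption data with `A = ⅛ > 0` [decided toy] -/

/-- The absorbed families [decided toy]: the young family absorbs the old one when it is genuinely younger (`K ≥ 1`). [folklore] -/
def SabsP (K : ℕ) (b : Bool) : Finset Bool := if b = true ∧ 1 ≤ K then {false} else ∅

/-- `holder`: absorbed families are strictly older. [folklore] -/
theorem holderP (K : ℕ) : ∀ b b₀ : Bool, b₀ ∈ SabsP K b → bs K b₀ < bs K b := by
  intro b b₀ h
  unfold SabsP at h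
  split_ifs at h with hb
  · rw [Finset.mem_singleton] at h
    subst h
    rw [hb.1, bs_false, bs_true hb.2]
    exact Nat.zero_lt_one
  · simp at h

/-- `hsub`: absorbed families are live in the absorbing family's component at its birth. [folklore] -/
theorem hsubP (K : ℕ) : ∀ b : Bool, SabsP K b ⊆ SP K (bs K b) b := by
  intro b b₀ h
  have hlt := holderP K b b₀ h
  exact Finset.mem_filter.mpr ⟨Finset.mem_univ _, hlt.le, bs_le K b⟩

/-- The dressing sizes [decided toy]: `β_j = β₀·τ^{K−j}`, `β₀ = ½`. [folklore] -/
def βP (K : ℕ) (j : ℕ) : ℝ := 1 / 2 * (((128 : ℝ)⁻¹ ^ 3)) ^ (K - j)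

/-- **THE OLD FAMILY's TRANSPORTED ENVELOPE at scale `k`**: its single birth generation transported at the cell rate,
`envVar C ρ false k = C·ρ₀^k·gP K false`. [arith] [folklore] -/
theorem envVar_oldP (K : ℕ) (C : ℝ) (k : ℕ) :
    (TP K).envVar C (fun _ : ℕ => ((128 : ℝ) ^ 2)⁻¹ * alphaCell (1 / 2)) false k = C * rhoP ^ k * gP K false := by
  show ∑ k' ∈ Finset.Icc (bs K false) k, C * stepProd (fun _ : ℕ => ((128 : ℝ) ^ 2)⁻¹ * alphaCell (1 / 2)) k' k *
      (if k' = bs K false then gP K false else 0) = C * rhoP ^ k * gP K false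
  rw [bs_false]
  have hterm : ∀ k' ∈ Finset.Icc 0 k, C * stepProd (fun _ : ℕ => ((128 : ℝ) ^ 2)⁻¹ * alphaCell (1 / 2)) k' k *
      (if k' = 0 then gP K false else 0) = if k' = 0 then C * rhoP ^ k * gP K false else 0 := by
    intro k' _
    split_ifs with h
    · subst h; rw [stepProd_const, Nat.sub_zero]; rfl
    · rw [mul_zero]
  rw [Finset.sum_congr rfl hterm, Finset.sum_ite_eq' (Finset.Icc 0 k) 0]
  simp

/-- **`habs` — THE ABSORPTION FORMAT WITH `A = ⅛`, AS AN EQUALITY FOR THE YOUNG FAMILY** [decided toy]: `C·gen b j_b ≤ β j_b +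
A·Σ_{b₀ ∈ Sabs b} envVar C ρ b₀ j_b` — for the old family the dressing alone (equality `½τ^K = ½τ^K`), for the young one (when
`K ≥ 1`) dressing PLUS `⅛ ×` the old family's transported envelope at scale `1` (equality); for ANY gate. [folklore] -/
theorem habsP (K : ℕ) (Gate : ℕ → Prop) :
    (TP K).AbsorbsFrom (4 * (1 / 2) / 1) (fun _ : ℕ => ((128 : ℝ) ^ 2)⁻¹ * alphaCell (1 / 2)) (βP K) (1 / 8) (SabsP K) Gate := by
  intro b _ _
  change Bool at b
  show 4 * (1 / 2) / 1 * (if bs K b = bs K b then gP K b else 0) ≤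
    βP K (bs K b) + 1 / 8 * ∑ b₀ ∈ SabsP K b,
      (TP K).envVar (4 * (1 / 2) / 1) (fun _ : ℕ => ((128 : ℝ) ^ 2)⁻¹ * alphaCell (1 / 2)) b₀ (bs K b)
  rw [if_pos rfl]
  unfold SabsP βP
  by_cases hb : b = true ∧ 1 ≤ K
  · rw [if_pos hb, Finset.sum_singleton, envVar_oldP, hb.1, bs_true hb.2]
    unfold gP
    rw [bs_true hb.2, bs_false, if_pos ⟨rfl, hb.2⟩, if_neg (by simp), add_zero, Nat.sub_zero, pow_one]
    exact le_of_eq (by ring)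
  · rw [if_neg hb, Finset.sum_empty, mul_zero, add_zero]
    unfold gP
    rw [if_neg hb, add_zero]
    exact le_of_eq (by ring)

/-- **THE ABSORPTION IS GENUINE** [decided toy]: for `K ≥ 1` the young family's booked birth generation STRICTLY exceeds its own
dressing `β 1` — the absorbed envelope `⅛·ρ₀·¼τ^K > 0` is really booked. [folklore] -/
theorem absorption_genuineP {K : ℕ} (hK : 1 ≤ K) :
    βP K (bs K true) < 4 * (1 / 2) / 1 * (TP K).gen true (bs K true) := by
  show βP K (bs K true) < 4 * (1 / 2) / 1 * (if bs K true = bs K true then gP K true else 0)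
  rw [if_pos rfl]
  unfold βP gP
  rw [if_pos ⟨rfl, hK⟩]
  have : 0 < 1 / 8 * rhoP * (1 / 4 * ((128 : ℝ)⁻¹ ^ 3) ^ K) := by have := rhoP_pos; positivity
  nlinarith [pow_pos tauP_pos (K - bs K true)]

/-- (w5) `hreg`: no regeneration (each family has its birth generation only), for ANY gate — DECLARED ≡ 0 (W10 carries live
regeneration). [folklore] -/
theorem hregP (K : ℕ) (Gate : ℕ → Prop) : (TP K).RegeneratesFromVar (fun _ : ℕ => (0 : ℝ)) Gate := by
  intro b k hbk _ _
  change Bool at b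
  have hbk' : bs K b ≤ k := hbk
  show (if k + 1 = bs K b then gP K b else 0) ≤ 0 * ((BP K).size b k)
  rw [if_neg (by omega), zero_mul]

/-! ## §3 The ONE scalar set [decided toy] -/

/-- `1 ≤ 128`. [folklore] -/ theorem hLP : (1 : ℝ) ≤ 128 := by norm_num
/-- The blocking INTEGER is the cell's `L`. [folklore] -/ theorem hLbP : ((128 : ℕ) : ℝ) = 128 := by norm_num
/-- (w6) THE SLICE-WINDOW SMALLNESS with EQUALITY: `m·(N₀·A₀∕(1−ρ′)) = ⅛·(2·1·2) = ½ ≤ 1 − s̄⁰ = ½`. [folklore] -/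
theorem hsmallP : (1 / 8 : ℝ) * (2 * 1 * (1 - 1 / 2)⁻¹) ≤ 1 - 1 / 2 := by norm_num
/-- The anchoring's count dominates the live families: `v·mB = 1·2 ≤ N₀ = 2`. [folklore] -/
theorem hvN₀P : (((1 : ℕ) : ℝ)) * ((2 : ℕ) : ℝ) ≤ 2 := by norm_num
/-- The absorption fan-out `A·N₀∕(1−ρ′) = ⅛·2·2 = ½ < 1`. [folklore] -/
theorem hfanP : fanout (1 / 8) 2 (1 / 2) < 1 := by unfold fanout; norm_num
/-- The absorbed amplitude `β₀∕(1 − fan-out) = ½∕½ = 1 ≤ A₀ = 1`. [folklore] -/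
theorem hampP : absorbAmplitude (1 / 2) (1 / 8) 2 (1 / 2) ≤ 1 := by unfold absorbAmplitude fanout; norm_num

/-! ## §4 THE CANONICAL TERMINAL FACE FIRES on the two-family datum [decided toy] -/

/-- **THE CANONICAL TERMINAL FACE FIRES — CONSTANTS DISPLAYED** [decided toy]: `DressedStabilityWith towerP 1 (rhoOne 128⁻² 2 0 ½)
128⁻³` by ONE application of S3l's `dressedStabilityWith_of_canonicalSliceWinSchedules` BY NAME, with the single cutoff-free
schedule `fun _ _ => Wp`, the scalar set of §3 bound ONCE, and EVERY displayed binder inhabited by the toy's per-cutoff lemmas: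
births `hslP` at scales `0` AND `1`, the live step law `FnP_succ` (both families, one shared exponent), the CROSS-FAMILY dictionary
`hQP`∕`hSgP` over `SgP`, (w2-act) for the zero action exponent (`realBaseAt_W`, `exponentSliceAt_M` — DECLARED ≡ 0), the (I4′)
links `hδfP`∕`hδfwkP`∕`hdefwkP`∕`hrateP`∕`hcmP`, the fresh pairs `relGauge_pairsP`, the booking convention `hneP`∕`hsupP`, (w5)
`hregP` (≡ 0), the anchoring `anchP`∕`hmultP`∕`hscaleP`∕`hhousedP`∕`hvolP` at the INTEGER `128`, and the absorption data
`holderP`∕`hsubP`∕`habsP` (A = ⅛) ∕ `hβ` (equality).  Non-vacuity of the binder SHAPES of S3l; nothing of Bałaban's densities. [folklore] -/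
theorem dressedStabilityWith_towerP :
    DressedStabilityWith towerP 1 (rhoOne ((128 : ℝ) ^ 2)⁻¹ (4 * (1 / 2) / 1) 0 (1 / 2)) ((128 : ℝ)⁻¹ ^ 3) :=
  dressedStabilityWith_of_canonicalSliceWinSchedules towerP (κ := 1 / 2) (L := 128) (cbar := 0) (N₀ := 2) (A₀ := 1)
    (sbar := 1 / 2) (ρ' := 1 / 2) (r := 1) (cδ := 1 / 2) (m := 1 / 8) (w := fun _ _ => 1) (fun _ _ => Wp) (by norm_num)
    (Fn := fun _ K f k' k => FnP K f k' k) (rel := fun _ _ _ _ _ U U' => U = U') (ref := fun _ _ _ _ U => U)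
    (base := fun _ _ _ _ => base₁) (𝒜 := fun _ _ _ _ => zeroExp) (𝒬 := fun _ K _ k => 𝒬P K k) (q := fun _ _ _ _ _ => 0)
    (μ := fun _ _ _ k => flAt (atomP (k + 1))) (z₀ := fun _ _ _ _ => 0) (z₁ := fun _ _ _ _ => 0)
    (defect := fun _ _ _ _ k => defP (k + 1)) (s := fun _ _ _ _ => 0) (S := fun _ K k b => SP K k b)
    (Sg := fun _ K k b => SgP K k b) (c := fun _ _ _ _ => (((1 / 8 : ℝ)) : ℂ)) (δf := fun _ _ _ k _ => dfP k)
    (creg := fun _ _ _ => 0) (Lb := 128) (mB := 2) (v := 1) (fun _ K => anchP K) (comp := fun _ K k b => compP K k b)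
    (Sabs := fun _ K b => SabsP K b) (β := fun _ K j => βP K j) (A := 1 / 8) (β₀ := 1 / 2)
    (fun _ _ => hratioP) hLP le_rfl (by norm_num) zero_le_one (by norm_num) hlocP (by norm_num) hsmallP one_pos (by norm_num)
    (fun _ K b k' _ _ _ => birthSlice_anti_window (hslP K b k') (Wp.hwcw k'))
    (fun _ K f k' k _ _ _ _ U => FnP_succ K f k' k U) (fun _ _ _ _ k _ _ _ _ _ => mem_bddClass_flAt _ _)
    (fun _ _ _ _ k _ _ _ _ => realBaseAt_W _ _) (fun _ _ _ _ k _ _ _ _ => exponentSliceAt_M _ _ _ _)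
    (fun _ _ _ k x _ => hδfP k x.2) (fun _ _ _ k => hDμP k) (fun _ _ _ k => hz₁P k)
    (fun _ _ _ _ k _ _ _ _ U₀ _ pd _ _ => (relGauge_pairsP k).mono fun z hz t _ => hz (latMove U₀ pd t))
    (fun _ _ _ _ _ _ _ h => h ▸ rfl) (fun _ _ _ _ _ k _ => aesm_flAt _ _) (fun _ _ _ _ k => hdefwkP k)
    (fun _ _ _ k' k _ _ _ => hrateP k' k) (fun _ _ b _ k _ _ _ _ => hneP b k) (fun _ K b k' k _ _ _ _ => hsupP K b k' k)
    (fun _ _ _ => le_rfl) (fun _ _ _ _ => le_rfl) (fun _ K => hregP K _) (fun _ _ _ _ => by norm_num) hLbP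
    (fun _ K => hmultP K) (fun _ K => hscaleP K) (fun _ K => hhousedP K) (fun _ K => hvolP K) (fun _ K => holderP K)
    (fun _ K => hsubP K) (fun _ K => habsP K _) (fun _ _ _ _ => le_rfl) (fun _ K b k => hQP K b k) (fun _ K => hSgP K)
    (fun _ _ _ _ => hcmP) (fun _ _ _ k _ _ => hδfwkP k) hvN₀P (by norm_num) hfanP hampP

/-- **THE CANONICAL TERMINAL FACE FIRES — THE ROW ROOT `DressedStability towerP` LITERALLY** [decided toy], from the displayed-
constants form (exactly as S3l's `dressedStability_of_canonicalSliceWinSchedules` packages its With-form). [folklore] -/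
theorem dressedStability_towerP : DressedStability towerP := ⟨_, _, _, dressedStabilityWith_towerP⟩

/-- **ROOT-B ON THE TWO-FAMILY TOWER THROUGH THE CANONICAL TERMINAL BUDGET THEOREM** [decided toy]: for EVERY run-weight family
`0 ≤ wt () K j ≤ w̄` (`j ≤ K`), `DressedBudget towerP wt` by S3l's `dressedBudget_of_canonicalSliceWinSchedules` BY NAME — the same
≈ 50 binders, the weights, and `1 ≤ v`.  The weights are external run data, not asserted. [folklore] -/
theorem dressedBudget_towerP {wbar : ℝ} {wt : Unit → ℕ → ℕ → ℝ} (hwbar : 0 ≤ wbar)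
    (hw0 : ∀ p K, ∀ j ≤ K, 0 ≤ wt p K j) (hwb : ∀ p K, ∀ j ≤ K, wt p K j ≤ wbar) : DressedBudget towerP wt :=
  dressedBudget_of_canonicalSliceWinSchedules towerP (κ := 1 / 2) (L := 128) (cbar := 0) (N₀ := 2) (A₀ := 1)
    (sbar := 1 / 2) (ρ' := 1 / 2) (r := 1) (cδ := 1 / 2) (m := 1 / 8) (w := fun _ _ => 1) (fun _ _ => Wp) (by norm_num)
    (Fn := fun _ K f k' k => FnP K f k' k) (rel := fun _ _ _ _ _ U U' => U = U') (ref := fun _ _ _ _ U => U)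
    (base := fun _ _ _ _ => base₁) (𝒜 := fun _ _ _ _ => zeroExp) (𝒬 := fun _ K _ k => 𝒬P K k) (q := fun _ _ _ _ _ => 0)
    (μ := fun _ _ _ k => flAt (atomP (k + 1))) (z₀ := fun _ _ _ _ => 0) (z₁ := fun _ _ _ _ => 0)
    (defect := fun _ _ _ _ k => defP (k + 1)) (s := fun _ _ _ _ => 0) (S := fun _ K k b => SP K k b)
    (Sg := fun _ K k b => SgP K k b) (c := fun _ _ _ _ => (((1 / 8 : ℝ)) : ℂ)) (δf := fun _ _ _ k _ => dfP k)
    (creg := fun _ _ _ => 0) (Lb := 128) (mB := 2) (v := 1) (fun _ K => anchP K) (comp := fun _ K k b => compP K k b)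
    (Sabs := fun _ K b => SabsP K b) (β := fun _ K j => βP K j) (A := 1 / 8) (β₀ := 1 / 2)
    (fun _ _ => hratioP) hLP le_rfl (by norm_num) zero_le_one (by norm_num) hlocP (by norm_num) hsmallP one_pos (by norm_num)
    (fun _ K b k' _ _ _ => birthSlice_anti_window (hslP K b k') (Wp.hwcw k'))
    (fun _ K f k' k _ _ _ _ U => FnP_succ K f k' k U) (fun _ _ _ _ k _ _ _ _ _ => mem_bddClass_flAt _ _)
    (fun _ _ _ _ k _ _ _ _ => realBaseAt_W _ _) (fun _ _ _ _ k _ _ _ _ => exponentSliceAt_M _ _ _ _)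
    (fun _ _ _ k x _ => hδfP k x.2) (fun _ _ _ k => hDμP k) (fun _ _ _ k => hz₁P k)
    (fun _ _ _ _ k _ _ _ _ U₀ _ pd _ _ => (relGauge_pairsP k).mono fun z hz t _ => hz (latMove U₀ pd t))
    (fun _ _ _ _ _ _ _ h => h ▸ rfl) (fun _ _ _ _ _ k _ => aesm_flAt _ _) (fun _ _ _ _ k => hdefwkP k)
    (fun _ _ _ k' k _ _ _ => hrateP k' k) (fun _ _ b _ k _ _ _ _ => hneP b k) (fun _ K b k' k _ _ _ _ => hsupP K b k' k)
    (fun _ _ _ => le_rfl) (fun _ _ _ _ => le_rfl) (fun _ K => hregP K _) (fun _ _ _ _ => by norm_num) hLbP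
    (fun _ K => hmultP K) (fun _ K => hscaleP K) (fun _ K => hhousedP K) (fun _ K => hvolP K) (fun _ K => holderP K)
    (fun _ K => hsubP K) (fun _ K => habsP K _) (fun _ _ _ _ => le_rfl) (fun _ K b k => hQP K b k) (fun _ K => hSgP K)
    (fun _ _ _ _ => hcmP) (fun _ _ _ k _ _ => hδfwkP k) hvN₀P (by norm_num) hfanP hampP hwbar hw0 hwb le_rfl

/-- [decided toy] The closed instance: unit run weights, `DressedBudget towerP 1`. [folklore] -/
theorem dressedBudget_towerP_one : DressedBudget towerP fun _ _ _ => 1 :=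
  dressedBudget_towerP (wbar := 1) zero_le_one (fun _ _ _ _ => zero_le_one) fun _ _ _ _ => le_rfl

end Summit.QuantumFields.BalabanUV.T4Continuum.NE1p.DressedTowerWitnessPair

end
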